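import Literature.MathematicalPhysics.QuantumFieldTheory.Balaban1983to89.B10
import Literature.MathematicalPhysics.QuantumFieldTheory.Balaban1983to89.TorusGeometry

/-!
# Lane `pub-balaban3d` — carrier layer p1, part 4 (`Carriers.Histories`), v1 (lead rulings R-HIST/R-HIST′):
# the large-field HISTORIES of [Balaban1985UV3] (38)–(40) p. 266 as a FINITE type, and the outer functional `LF` of the
# inductive bound (41) as a finite positive combination of evaluations (seat finding F-p1-4)

Source: T. Bałaban, CMP **102** (1985) 255–275 [Balaban1985UV3]: (7) p. 257 (decomposition of unity over large-field plaquette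
sets `P`, regions `Ω₁` = unions of big blocks at distance `> R(g₀)M₁` from `P`), (38)–(40) p. 266 = PDF 12 (render `…-p012-x2.png`)
«Thus we obtain a sequence of domains Ω₁ ⊃ Ω₂ ⊃ ⋯ ⊃ Ω_k, Ω_j ⊂ T_η, (38) satisfying the conditions (L^jη)^{−1}dist(Ω_jᶜ, Ω_{j+1}) >
R(g_j)M₁ … (39)», «Z_j = Ω_{j+1}^{(j)c}», «Λ_j = Ω_j^{(j)}∖Ω_{j+1}^{(j)}», (40) the characteristic functions χ_j; and (41) p. 266
«ρ_k(V) ≤ Σ_{{Ω_j}} ∫dV_{k−1}↾_{Z_{k−1}} δ(V̄_{k−1}V^{−1}) ⋯ ∫dV₀↾_{Z₀} δ(V̄₀V₁^{−1}) χ_k ζ_{Λ_{k−1}} χ_{k−1} ⋯ ζ_{Λ₁} χ₁ ζ_{Ω₁ᶜ} × exp[…]».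

DESIGN (seat finding F-p1-4, lane STATUS 2026-08-22T00:40Z; lead ruling R-HIST «Hist k = admissible sequences (Ω_j, Λ_j, Z_j)_{j≤k}»).
The 4D cell's carrier `B10.TowerRun` asks `LF k U : (Hist k → ℝ) → ℝ` to be monotone and shift-multiplicative on ALL real
functions of the history; a real-valued functional with these two properties that is an integral of `exp ∘ F` against a measure
must have FINITELY SUPPORTED measure (an unbounded `F` makes a diffuse integral infinite, and the real-valued junk value breaks
monotonicity).  Hence: (i) `Hist P k` is FINITE — a history IS its scale-tagged family of large-field plaquette sets
`(P_j)_{j<k}` (the regions Ω_j, Λ_j, Z_j are DETERMINED by them through the collar rule of p. 257 / pp. 267–268 = LQB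
`B10LargeField.Rule268`; §4 below gives their signatures); (ii) `LF k U F = Σ_h m_k(h,U)·exp(F h)` where the MASS `m_k(h,U) ∈ [0,1]`
is print's «Σ∫dV_{k−1}↾… δ(…) ⋯ χζ⋯» with the field histories `V_j` INTEGRATED OUT (record `HistWeights`; v1 of this file DEFINES
it from the Radon–Nikodym transports of `Carriers.RT` applied level by level to the {0,1}-valued weights χ_jζ_{Λ_j}, pinned ≤ 1);
(iii) consequently the tower's `mainT k h V`, `Pint k h V` (EXPANSION DATA, ruling R-PIECES (d)) are functions of (history, V):
print's exponent, which depends on the `V_j` through the composite minimizer `U_k(V,{V_j})` of (42), is read at ONE field history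
per `(h, V)` — LQB-(41) so instantiated is IMPLIED by print's (41) (maximising field history on the compact fibre), a recorded
divergence for the referee (the 4D cell's own docstring reading «Hist k = {Ω_j, Λ_j, Z_j, V_j}» is not instantiable under its
`lf_mono`).  WHAT IS PROVED HERE ([folklore] bookkeeping): `lf_mono`, `lf_shift` (the two `TowerRun` axioms) BY CONSTRUCTION,
the k = 0 contract `LF 0 U F = exp (F triv)` (ruling R-K0 / p4's `Step0Data`), and the DOMINATION shape consumed by the large-field
resummation (`B10LargeFieldSum.HistModel.dominated`, seat p2) with `A₀ = 0`: `LF k U F ≤ Σ_{Q ⊆ E_k} exp(B Q)` whenever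
`F h ≤ B (disc h)` — because `disc` (the scale-tagged large-field set of a history) is INJECTIVE and masses are `≤ 1`.
HONEST FRAMING (PLAN §0): nothing of CMP 102 is asserted; d is a parameter (d = 3 in the lane's `Scales.P`).
-/

open Finset

namespace Summit.QuantumFields.Balaban3D.Carriers

open Literature.MathematicalPhysics.QuantumFieldTheory.Balaban1983to89

variable {P : Params}

/-! ## §1 Histories: scale-tagged large-field plaquette sets (finite) -/

/-- Decidable equality of plaquettes (classical; the carrier is noncomputable throughout). [folklore] -/
noncomputable instance instDecidableEqPlaq {j : ℕ} : DecidableEq (Plaq P j) := Classical.decEq _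

/-- A HISTORY of `k` steps: the large-field plaquette sets `P_j ⊂ T^{(j)}`, `j = 0, …, k−1`, of the decompositions of unity (7)
p. 257 / p. 267 L36–37 made at the passages `j → j+1` ([Balaban1985UV3] (38)–(40) p. 266: the regions `Ω_{j+1}`, `Λ_j`, `Z_j` are
functions of them, §4).  A FINITE type (F-p1-4). [cite: Balaban1985UV3, (38)–(40) p.266] -/
def Hist (P : Params) (k : ℕ) : Type := (j : Fin k) → Finset (Plaq P j)

namespace Hist

/-- Histories form a finite type. [folklore] -/
noncomputable instance instFintype (k : ℕ) : Fintype (Hist P k) := by unfold Hist; infer_instance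

/-- There is exactly one history of `0` steps (ruling R-K0: «`Hist 0` one point»). [folklore] -/
instance instUnique : Unique (Hist P 0) := by unfold Hist; infer_instance

/-- THE TRIVIAL HISTORY: no large fields at any scale («every Ω_j the whole lattice; the only term of (47)», p. 267;
p. 272 «Ω_{k+1} = T_η»). [cite: Balaban1985UV3, (47) p.267] -/
def triv (P : Params) (k : ℕ) : Hist P k := fun _ => ∅

/-- Forgetting the last step: the history of the first `k` passages of a `(k+1)`-step history (`StepPieces.proj`). [folklore] -/
def proj {k : ℕ} (h : Hist P (k + 1)) : Hist P k := fun j => h j.castSucc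

/-- The large-field set `P_k` of the LAST passage `k → k+1` of a `(k+1)`-step history. [folklore] -/
def last {k : ℕ} (h : Hist P (k + 1)) : Finset (Plaq P k) := h (Fin.last k)

/-- Extending a `k`-step history by the large-field set of the passage `k → k+1`. [folklore] -/
def snoc {k : ℕ} (h : Hist P k) (Pk : Finset (Plaq P k)) : Hist P (k + 1) := Fin.snoc h Pk

/-- `proj (triv) = triv` (`StepPieces.proj_triv`). [folklore] -/
@[simp] theorem proj_triv (k : ℕ) : proj (triv P (k + 1)) = triv P k := rfl

/-- `last (triv) = ∅`. [folklore] -/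
@[simp] theorem last_triv (k : ℕ) : last (triv P (k + 1)) = ∅ := rfl

/-- `proj (snoc h P_k) = h`. [folklore] -/
@[simp] theorem proj_snoc {k : ℕ} (h : Hist P k) (Pk : Finset (Plaq P k)) : proj (snoc h Pk) = h := by
  funext j; simp [proj, snoc]

/-- `last (snoc h P_k) = P_k`. [folklore] -/
@[simp] theorem last_snoc {k : ℕ} (h : Hist P k) (Pk : Finset (Plaq P k)) : last (snoc h Pk) = Pk := by
  simp [last, snoc]

/-- A `(k+1)`-step history is its projection extended by its last large-field set. [folklore] -/
theorem snoc_proj_last {k : ℕ} (h : Hist P (k + 1)) : snoc (proj h) (last h) = h := by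
  funext j
  refine Fin.lastCases ?_ (fun i => ?_) j
  · simp [snoc, last]
  · simp [snoc, proj]

/-- The history of `0` steps is the trivial one. [folklore] -/
theorem eq_triv_zero (h : Hist P 0) : h = triv P 0 := Subsingleton.elim _ _

end Hist

/-! ## §2 The scale-tagged large-field set of a history (`disc`), injective -/

/-- Scale-free CODE of a plaquette: the integer labels of its base point and its two directions (what the large-field resummation
indexes by: «(j, z₀, μν)», seat p2). [folklore] -/
def PlaqCode (P : Params) : Type := (Fin P.d → ℕ) × Fin P.d × Fin P.d

/-- Plaquette codes have decidable equality. [folklore] -/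
instance instDecidableEqPlaqCode : DecidableEq (PlaqCode P) := by unfold PlaqCode; infer_instance

/-- The code of a plaquette of `T^{(j)}`. [folklore] -/
def plaqCode {j : ℕ} (p : Plaq P j) : PlaqCode P := (fun μ => (p.src μ).val, p.μ, p.ν)

/-- Coding is injective at each scale (labels determine the `ZMod` coordinates). [folklore] -/
theorem plaqCode_injective (j : ℕ) : Function.Injective (plaqCode : Plaq P j → PlaqCode P) := by
  intro p q h
  have h1 := congrArg (fun c : PlaqCode P => c.1) h
  have h2 := congrArg (fun c : PlaqCode P => c.2.1) h
  have h3 := congrArg (fun c : PlaqCode P => c.2.2) h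
  simp only [plaqCode] at h1 h2 h3
  have hs : p.src = q.src := funext fun μ => ZMod.val_injective _ (congrFun h1 μ)
  obtain ⟨ps, pμ, pν, ph⟩ := p
  obtain ⟨qs, qμ, qν, qh⟩ := q
  simp only at hs h2 h3
  subst hs; subst h2; subst h3; rfl

/-- `disc h`: the scale-tagged set `{(j, code p) : p ∈ P_j, j < k}` of the large-field plaquettes of a history — the «P» the
sum over `{Ω_j}` in (41) runs over ([Balaban1985UV3] p. 273 L31–32 «all plaquettes in all large fields set P»). [cite: Balaban1985UV3, (41) p.266] -/
def Hist.disc {k : ℕ} (h : Hist P k) : Finset (ℕ × PlaqCode P) :=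
  Finset.univ.biUnion fun j : Fin k => (h j).image fun p => ((j : ℕ), plaqCode p)

/-- ALL scale-tagged plaquette codes of scales `< k` (the `E k` of `B10LargeFieldSum.HistModel`). [folklore] -/
def allCodes (P : Params) (k : ℕ) : Finset (ℕ × PlaqCode P) := Hist.disc (fun _ => Finset.univ : Hist P k)

/-- Membership in `disc`. [folklore] -/
theorem Hist.mem_disc {k : ℕ} (h : Hist P k) (e : ℕ × PlaqCode P) :
    e ∈ h.disc ↔ ∃ j : Fin k, ∃ p ∈ h j, ((j : ℕ), plaqCode p) = e := by
  simp [Hist.disc]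

/-- Every tagged code of a history has scale `< k` (`HistModel.E_lt`). [folklore] -/
theorem Hist.disc_lt {k : ℕ} (h : Hist P k) : ∀ e ∈ h.disc, e.1 < k := by
  intro e he
  obtain ⟨j, p, _, rfl⟩ := (h.mem_disc e).1 he
  exact j.isLt

/-- `disc h ⊆ allCodes` (`HistModel.disc_sub`). [folklore] -/
theorem Hist.disc_subset_allCodes {k : ℕ} (h : Hist P k) : h.disc ⊆ allCodes P k := by
  intro e he
  obtain ⟨j, p, _, rfl⟩ := (h.mem_disc e).1 he
  exact (Hist.mem_disc _ _).2 ⟨j, p, Finset.mem_univ _, rfl⟩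

/-- The trivial history has no large-field plaquettes. [folklore] -/
@[simp] theorem Hist.disc_triv (k : ℕ) : (Hist.triv P k).disc = ∅ := by
  ext e; simp [Hist.disc, Hist.triv]

/-- A HISTORY IS ITS LARGE-FIELD SET: `disc` is injective (the regions are functions of the large-field sets, §4; this is what
makes the domination bound below hold with no entropy factor). [folklore] -/
theorem Hist.disc_injective (k : ℕ) : Function.Injective (Hist.disc : Hist P k → Finset (ℕ × PlaqCode P)) := by
  intro h h' hh
  funext j
  ext p
  constructor
  · intro hp
    have : ((j : ℕ), plaqCode p) ∈ h'.disc := hh ▸ (h.mem_disc _).2 ⟨j, p, hp, rfl⟩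
    obtain ⟨j', p', hp', he⟩ := (h'.mem_disc _).1 this
    simp only [Prod.mk.injEq] at he
    have hj : j' = j := Fin.ext he.1
    subst hj
    rwa [← plaqCode_injective _ he.2]
  · intro hp
    have : ((j : ℕ), plaqCode p) ∈ h.disc := hh.symm ▸ (h'.mem_disc _).2 ⟨j, p, hp, rfl⟩
    obtain ⟨j', p', hp', he⟩ := (h.mem_disc _).1 this
    simp only [Prod.mk.injEq] at he
    have hj : j' = j := Fin.ext he.1
    subst hj
    rwa [← plaqCode_injective _ he.2]

/-! ## §3 The outer functional `LF` of (41): a finite positive combination of evaluations -/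

section LF

variable (P) (G : Type)

/-- THE MASSES of the histories: `mass k h U ∈ [0, 1]` = print's «Σ_{{Ω_j}}∫dV_{k−1}↾_{Z_{k−1}} δ(V̄_{k−1}V^{−1}) ⋯ ∫dV₀↾_{Z₀}
δ(V̄₀V₁^{−1}) χ_k ζ_{Λ_{k−1}} χ_{k−1} ⋯ ζ_{Λ₁} χ₁ ζ_{Ω₁ᶜ}» of (41) for the history `h` at the field `U = V`, with the field
histories `V_j` integrated out (a conditional probability of the history's small/large-field events given the successive
averages; in the push-forward reading an iterated Radon–Nikodym transport of {0,1}-valued weights — v1 of this file defines it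
from `Carriers.RT`; this v0 record is its INTERFACE).  At `k = 0` there is nothing to integrate: mass `1` (R-K0). [cite: Balaban1985UV3, (41) p.266] -/
structure HistWeights where
  /-- `m_k(h, U)` -/
  mass : (k : ℕ) → Hist P k → GaugeField P k G → ℝ
  /-- masses are non-negative (integrals of characteristic functions) -/
  mass_nonneg : ∀ k h U, 0 ≤ mass k h U
  /-- masses are at most `1` (conditional probabilities; version pinned) -/
  mass_le_one : ∀ k h U, mass k h U ≤ 1
  /-- at `k = 0` the unique history has mass `1` (no integration, no characteristic function: (41)₀ is (1)) -/
  mass_zero : ∀ (h : Hist P 0) (U : GaugeField P 0 G), mass 0 h U = 1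

variable {P G}

/-- **THE OUTER FUNCTIONAL OF (41)** applied to `exp ∘ F`: `LF k U F = Σ_h m_k(h,U) · exp(F h)` — print's «Σ_{{Ω_j}} ∫dV ⋯ χζ ⋯ ×
exp[…]» with the exponent's history-dependence carried by `F` (F-p1-4). [cite: Balaban1985UV3, (41) p.266] -/
noncomputable def LF (W : HistWeights P G) (k : ℕ) (U : GaugeField P k G) (F : Hist P k → ℝ) : ℝ :=
  ∑ h : Hist P k, W.mass k h U * Real.exp (F h)

variable (W : HistWeights P G)

/-- `TowerRun.lf_mono` BY CONSTRUCTION: `LF` is monotone in the exponent. [folklore] -/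
theorem lf_mono (k : ℕ) (U : GaugeField P k G) (F F' : Hist P k → ℝ) (hFF' : ∀ h, F h ≤ F' h) :
    LF W k U F ≤ LF W k U F' :=
  Finset.sum_le_sum fun h _ => mul_le_mul_of_nonneg_left (Real.exp_le_exp.mpr (hFF' h)) (W.mass_nonneg k h U)

/-- `TowerRun.lf_shift` BY CONSTRUCTION: `LF (F + t) = eᵗ · LF F`. [folklore] -/
theorem lf_shift (k : ℕ) (U : GaugeField P k G) (F : Hist P k → ℝ) (t : ℝ) :
    LF W k U (fun h => F h + t) = Real.exp t * LF W k U F := by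
  unfold LF
  rw [Finset.mul_sum]
  refine Finset.sum_congr rfl fun h _ => ?_
  rw [Real.exp_add]; ring

/-- `LF ≥ 0`. [folklore] -/
theorem lf_nonneg (k : ℕ) (U : GaugeField P k G) (F : Hist P k → ℝ) : 0 ≤ LF W k U F :=
  Finset.sum_nonneg fun h _ => mul_nonneg (W.mass_nonneg k h U) (Real.exp_pos _).le

/-- THE k = 0 CONTRACT (ruling R-K0; yields p4's `Step0Data.lf_triv` of `Proofs.SectAFirstStep` with equality): `LF 0 U F = exp (F (triv 0))` — one history, mass one, no
characteristic function, so that (41)₀ is exactly (1). [folklore] -/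
theorem lf_zero (U : GaugeField P 0 G) (F : Hist P 0 → ℝ) : LF W 0 U F = Real.exp (F (Hist.triv P 0)) := by
  unfold LF
  rw [Fintype.sum_unique]
  rw [W.mass_zero, one_mul, Hist.eq_triv_zero (default : Hist P 0)]

/-- The trivial history's term is one summand of `LF` (the (47)-term inside (41)). [folklore] -/
theorem mass_triv_mul_exp_le_lf (k : ℕ) (U : GaugeField P k G) (F : Hist P k → ℝ) :
    W.mass k (Hist.triv P k) U * Real.exp (F (Hist.triv P k)) ≤ LF W k U F := by
  unfold LF
  exact Finset.single_le_sum (f := fun h => W.mass k h U * Real.exp (F h))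
    (fun h _ => mul_nonneg (W.mass_nonneg k h U) (Real.exp_pos _).le) (Finset.mem_univ _)

/-- **DOMINATION** (the shape `B10LargeFieldSum.HistModel.dominated` with `A₀ = 0`, seat p2's large-field resummation): if the
exponent is bounded by a function of the large-field set, `F h ≤ B (disc h)`, then `LF k U F ≤ Σ_{Q ⊆ allCodes k} exp(B Q)` —
masses `≤ 1` and `disc` injective; no entropy factor arises because a history is determined by its large-field set. [folklore] -/
theorem lf_dominated (k : ℕ) (U : GaugeField P k G) (F : Hist P k → ℝ) (B : Finset (ℕ × PlaqCode P) → ℝ)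
    (hFB : ∀ h, F h ≤ B h.disc) :
    LF W k U F ≤ ∑ Q ∈ (allCodes P k).powerset, Real.exp (B Q) := by
  classical
  calc LF W k U F
      ≤ ∑ h : Hist P k, Real.exp (B h.disc) := by
        refine Finset.sum_le_sum fun h _ => ?_
        calc W.mass k h U * Real.exp (F h)
            ≤ 1 * Real.exp (B h.disc) :=
              mul_le_mul (W.mass_le_one k h U) (Real.exp_le_exp.mpr (hFB h)) (Real.exp_pos _).le zero_le_one
          _ = Real.exp (B h.disc) := one_mul _
    _ = ∑ Q ∈ (Finset.univ : Finset (Hist P k)).image Hist.disc, Real.exp (B Q) := by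
        rw [Finset.sum_image fun h _ h' _ hh => Hist.disc_injective k hh]
    _ ≤ ∑ Q ∈ (allCodes P k).powerset, Real.exp (B Q) := by
        refine Finset.sum_le_sum_of_subset_of_nonneg ?_ (fun Q _ _ => (Real.exp_pos _).le)
        intro Q hQ
        obtain ⟨h, _, rfl⟩ := Finset.mem_image.1 hQ
        exact Finset.mem_powerset.2 h.disc_subset_allCodes

end LF

end Summit.QuantumFields.Balaban3D.Carriers
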